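import Literature.NumberTheory.Rogawski1990.FinExplicitTransferFactorGHRegular      -- ★ `finKappaAt_eq_one_or_eq_neg_one_of_isUnit`, `isUnit_finTauArg_of_isUnit`; brings ★ `…Nondegenerate` (`isUnit_eval_finCharpolyTwo_of_isLocalGRegular`, `isUnit_finGammaTwo`)
import Literature.NumberTheory.Automorphic.TorusCharacterLocalComponents              -- ★ `semilocalComponent_apply`
import HarnessLib

/-!
# F0 · P3c · line LH6 «StCharTS» — road «1252 ∕ ELL-INNER», brick (E3) «UNIT WEIGHTS»: `‖τ_v(γ_H)‖ = 1` and `κ_v(γ_H, γ′)² = 1` on the `G`-regular matching pairs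
# [Rogawski1990, §4.9 p. 55; §14.6 p. 242; §12.5 Prop. 12.5.2 (proof) pp. 184–185]

Cell `pub/hodgecm-mathlib`, crux H413 = `stmt-HodgeConjecture-24833` (lane `--kind proof --supports … --as helper`, count-neutral), route HCCMUnconditional;
seat LH3-p03 (g9), DEFAULT work under the desk frame 19:40:31Z («census first, HOME-first») on CENSUS «1252 ∕ ELL-INNER» v1 (LH6-p03 (g7),
`F0/P3b/LH6-p03/g7/CENSUS-1252-ELL-INNER.v1.LH6p03g7.md` 06afd1d3d7b1895d) §(c) row (E3); desk word 19:53:05Z «ROAD AFTER UP-TR» READ.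

WHAT.  In the proof of Prop. 12.5.2 (p. 185) the product of the two Lemma-12.5.1 sums `D_G α₁^G · conj(D_G α₂^G)` is expanded termwise; each diagonal term
carries the weight `τ(q)·conj τ(q) · κ(q,x)·κ(q,x)` in front of `D_H(q)² α₁(q) conj α₂(q)`, and print silently uses that this weight is `1`: `τ_v` is a
value of the UNITARY character `μ` («`|Δ_{G∕H}| = D_{G∕H}`», §4.9 p. 55) and `κ = ±1` (§14.6 p. 242).  This file types exactly that, for the tree's explicit
finite transfer-factor pieces ★ `finTau` ∕ ★ `finKappaAt` at a finite place `v` (split or not):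
* §1 `norm_finTau_eq_one` — `‖τ_v(γ_H)‖ = 1` for `μ` unitary and `γ_H` `G`-regular (the tree had only the inequality ★ `F0P3cStCharTSUpDom.norm_finTau_le_one`);
  `finTau_mul_conj_eq_one` — `τ · conj τ = 1`.
* §2 `finKappaAt_sq_eq_one` — `κ_v(γ_H, γ′)² = 1` on a matching pair with `γ_H` `G`-regular (one line over ★ `finKappaAt_eq_one_or_eq_neg_one_of_isUnit` +
  ★ `isUnit_eval_finCharpolyTwo_of_isLocalGRegular`); its `ℂ`-cast forms `intCast_finKappaAt_mul_self_eq_one`, `norm_intCast_finKappaAt_eq_one`.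
* §3 `finTau_mul_conj_mul_intCast_finKappaAt_mul_self_eq_one` — the (E8) diagonal-term combiner `τ·conj τ·(κ·κ) = 1`, and the rewriting form
  `weight_mul_conj_weight_eq` : `(τ·d·κ·z₁)·conj(τ·d·κ·z₂) = d² · (z₁ · conj z₂)` for REAL `d` (the `D_H(q)` slot) — ONE `rw` in the assembly (E8).
THEOREMS ONLY; sorry-free; no `def` ∕ `instance` ∕ `notation`; ★-only imports; axioms TRIO.  HONEST LABEL: count-neutral helper — it moves no consequent of
`hBlock′`; `𝔇.Prop1252` [Rogawski1990, §12.5 Prop. 12.5.2] stays PRINTED until a ★ rider removes it; HC_CM is proved only modulo the 7 printed citations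
(2 remaining: hLiu418 = `stmt-HodgeConjecture-24832`, h413 = `stmt-HodgeConjecture-24833`) until rung 0 closes.

## References
* [Rogawski1990] J. D. Rogawski, *Automorphic Representations of Unitary Groups in Three Variables*, Ann. of Math. Stud. 123 (1990): §4.9 p. 55 (`τ`,
  `|Δ_{G∕H}| = D_{G∕H}`); §14.6 p. 242 («`κ(γ, ψ_v(i(γ)))` is equal to `±1`»); §12.5 Prop. 12.5.2 (proof) pp. 184–185.
* [LanglandsShelstad1987] R. P. Langlands, D. Shelstad, *On the definition of transfer factors*, Math. Ann. 278 (1987), §1.3.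
-/

set_option autoImplicit false
-- the mandated namespace has the single-problem summit's repeated segment (`HodgeConjecture.HodgeConjecture`)
set_option linter.dupNamespace false

noncomputable section

open NumberField IsDedekindDomain
open scoped MatrixGroups ComplexConjugate
open Literature.NumberTheory.Rogawski1990 Literature.NumberTheory.Automorphic Literature.NumberTheory.Automorphic.UnitaryGroup
open Literature.NumberTheory.GaloisRepresentations

namespace Summit.HodgeConjecture.HodgeConjecture.Cruxes.H413.F0P3cStCharTSEllInnerUnitWeights

variable (L : Type) [Field L] [NumberField L] [IsCMField L] (v : HeightOneSpectrum (𝓞 ↥(maximalRealSubfield L)))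
  (H' : Matrix (Fin 3) (Fin 3) L)
  (a : (UnitaryGroup.cmDatum L 2 (Matrix.of fun i j : Fin 2 => if i.val + j.val + 1 = 2 then (1 : L) else 0)).Local v ×
      (UnitaryGroup.cmDatum L 1 (Matrix.of fun i j : Fin 1 => if i.val + j.val + 1 = 1 then (1 : L) else 0)).Local v)
  (b : (UnitaryGroup.cmDatum L 3 H').Local v)

/-! ## §1 `‖τ_v(γ_H)‖ = 1` for a unitary `μ` at a `G`-regular `γ_H` -/

omit [IsCMField L] in
/-- `μ_v` of a UNIT has norm `1` when `μ` is unitary. [cite: Rogawski1990, §4.9 p. 55] -/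
theorem norm_finHeckeValue_eq_one (μ : HeckeCharacter L) (hμ : μ.IsUnitary) {x : UnitaryGroup.LocalRing L v} (hx : IsUnit x) :
    ‖finHeckeValue L v μ x‖ = 1 := by
  rw [finHeckeValue_of_isUnit L v μ hx, semilocalComponent_apply, hμ]

/-- **(E3a) `‖τ_v(γ_H)‖ = 1`**: for a unitary `μ` and a `G`-regular `γ_H`, the factor `τ_v(γ_H) = μ_v(γ₂)·μ_v((γ₂γ₁⁻¹ − 1)(1 − γ₂γ₃⁻¹))⁻¹` is a quotient of two
values of the unitary character `μ` at UNITS of `E_v` (★ `isUnit_finGammaTwo`; ★ `isUnit_finTauArg_of_isUnit` with `χ_g(γ₂)` a unit by `G`-regularity,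
★ `isUnit_eval_finCharpolyTwo_of_isLocalGRegular`), hence of norm `1` — the equality behind «`|Δ_{G∕H}| = D_{G∕H}`».  (The tree's ★
`F0P3cStCharTSUpDom.norm_finTau_le_one` is the inequality at every `γ_H`.) [cite: Rogawski1990, §4.9 p. 55] -/
theorem norm_finTau_eq_one (μ : HeckeCharacter L) (hμ : μ.IsUnitary) (hreg : IsLocalGRegular L v a) : ‖finTau L v a μ‖ = 1 := by
  have hu := isUnit_eval_finCharpolyTwo_of_isLocalGRegular L v a hreg
  unfold finTau
  rw [norm_mul, norm_inv, norm_finHeckeValue_eq_one L v μ hμ (isUnit_finGammaTwo L v a),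
    norm_finHeckeValue_eq_one L v μ hμ (isUnit_finTauArg_of_isUnit L v a hu), inv_one, mul_one]

/-- **(E3a′) `τ_v(γ_H) · conj τ_v(γ_H) = 1`** (unitary `μ`, `G`-regular `γ_H`). [cite: Rogawski1990, §4.9 p. 55] -/
theorem finTau_mul_conj_eq_one (μ : HeckeCharacter L) (hμ : μ.IsUnitary) (hreg : IsLocalGRegular L v a) :
    finTau L v a μ * conj (finTau L v a μ) = 1 := by
  rw [Complex.mul_conj, Complex.normSq_eq_norm_sq, norm_finTau_eq_one L v a μ hμ hreg, one_pow, Complex.ofReal_one]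

/-! ## §2 `κ_v(γ_H, γ′)² = 1` on a matching pair with `γ_H` `G`-regular -/

open scoped Classical in
/-- **(E3b) `κ_v(γ_H, γ′)² = 1`** on a matching pair `ι_v(γ_H) ↔ γ′` with `γ_H` `G`-regular — at EVERY finite `v` (at a split `v` ★ `finKappaAt = +1` on the support;
at a non-split `v` it is `±1`): ★ `finKappaAt_eq_one_or_eq_neg_one_of_isUnit` with `χ_g(γ₂)` a unit by ★ `isUnit_eval_finCharpolyTwo_of_isLocalGRegular`.
[cite: Rogawski1990, §14.6 p. 242; §4.3 p. 43] [cite: LanglandsShelstad1987, §1.3] -/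
theorem finKappaAt_sq_eq_one (hp : IsLocalNormPair L H' v a b) (hreg : IsLocalGRegular L v a) : finKappaAt L v H' a b ^ 2 = 1 := by
  rcases finKappaAt_eq_one_or_eq_neg_one_of_isUnit L v H' a b hp (isUnit_eval_finCharpolyTwo_of_isLocalGRegular L v a hreg) with h | h <;>
    rw [h] <;> norm_num

open scoped Classical in
/-- `κ_v · κ_v = 1` in `ℤ` (matching pair, `γ_H` `G`-regular). [cite: Rogawski1990, §14.6 p. 242] -/
theorem finKappaAt_mul_self_eq_one (hp : IsLocalNormPair L H' v a b) (hreg : IsLocalGRegular L v a) :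
    finKappaAt L v H' a b * finKappaAt L v H' a b = 1 := by
  rw [← sq, finKappaAt_sq_eq_one L v H' a b hp hreg]

open scoped Classical in
/-- **(E3b, `ℂ`-cast) `(κ_v : ℂ) · (κ_v : ℂ) = 1`** — the form the weight in ★ `EllipticData.up` (the (UP-DEF) pin: `… * ((finKappaAt … : ℤ) : ℂ) * α q`) multiplies.
[cite: Rogawski1990, §14.6 p. 242; §12.5 Prop. 12.5.2 (proof) p. 185] -/
theorem intCast_finKappaAt_mul_self_eq_one (hp : IsLocalNormPair L H' v a b) (hreg : IsLocalGRegular L v a) :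
    ((finKappaAt L v H' a b : ℤ) : ℂ) * ((finKappaAt L v H' a b : ℤ) : ℂ) = 1 := by
  rw [← Int.cast_mul, finKappaAt_mul_self_eq_one L v H' a b hp hreg, Int.cast_one]

open scoped Classical in
/-- `conj (κ_v : ℂ) = (κ_v : ℂ)` (an integer). [cite: Rogawski1990, §14.6 p. 242] -/
theorem conj_intCast_finKappaAt : conj ((finKappaAt L v H' a b : ℤ) : ℂ) = ((finKappaAt L v H' a b : ℤ) : ℂ) :=
  map_intCast _ _

open scoped Classical in
/-- `‖(κ_v : ℂ)‖ = 1` (matching pair, `γ_H` `G`-regular; the tree's ★ `F0P3cStCharTSUpDom.norm_finKappaAt_le_one` is the inequality everywhere).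
[cite: Rogawski1990, §14.6 p. 242] -/
theorem norm_intCast_finKappaAt_eq_one (hp : IsLocalNormPair L H' v a b) (hreg : IsLocalGRegular L v a) :
    ‖((finKappaAt L v H' a b : ℤ) : ℂ)‖ = 1 := by
  rcases finKappaAt_eq_one_or_eq_neg_one_of_isUnit L v H' a b hp (isUnit_eval_finCharpolyTwo_of_isLocalGRegular L v a hreg) with h | h <;>
    rw [h] <;> simp

/-! ## §3 The (E8) diagonal-term combiner -/

open scoped Classical in
/-- **(E3) COMBINED — `τ·conj τ · (κ·κ) = 1`** on a `G`-regular matching pair for a unitary `μ`: the weight in front of `D_H(q)²·α₁(q)·conj α₂(q)` in every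
diagonal term of the expanded product of the two Lemma-12.5.1 sums (Prop. 12.5.2, proof, p. 185). [cite: Rogawski1990, §12.5 Prop. 12.5.2 (proof) pp. 184–185; §4.9 p. 55; §14.6 p. 242] -/
theorem finTau_mul_conj_mul_intCast_finKappaAt_mul_self_eq_one (μ : HeckeCharacter L) (hμ : μ.IsUnitary)
    (hp : IsLocalNormPair L H' v a b) (hreg : IsLocalGRegular L v a) :
    finTau L v a μ * conj (finTau L v a μ) * (((finKappaAt L v H' a b : ℤ) : ℂ) * ((finKappaAt L v H' a b : ℤ) : ℂ)) = 1 := by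
  rw [finTau_mul_conj_eq_one L v a μ hμ hreg, intCast_finKappaAt_mul_self_eq_one L v H' a b hp hreg, one_mul]

open scoped Classical in
/-- **(E3) REWRITING FORM for the assembly (E8)**: for a unitary `μ`, a `G`-regular matching pair, a REAL middle factor `d` (the `D_H(q)` slot, cast from `ℝ`)
and any two values `z₁ z₂ : ℂ` (the `α₁(q)`, `α₂(q)` slots):
`(τ · d · κ · z₁) · conj (τ · d · κ · z₂) = d² · (z₁ · conj z₂)` — the (UP-DEF) summand shape `finTau q μ * (D_H q : ℂ) * ((finKappaAt q x : ℤ) : ℂ) * α q` of the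
★ `hUp` pin, squared against its conjugate. [cite: Rogawski1990, §12.5 Prop. 12.5.2 (proof) p. 185] -/
theorem weight_mul_conj_weight_eq (μ : HeckeCharacter L) (hμ : μ.IsUnitary)
    (hp : IsLocalNormPair L H' v a b) (hreg : IsLocalGRegular L v a) (d : ℝ) (z₁ z₂ : ℂ) :
    finTau L v a μ * (d : ℂ) * ((finKappaAt L v H' a b : ℤ) : ℂ) * z₁ *
        conj (finTau L v a μ * (d : ℂ) * ((finKappaAt L v H' a b : ℤ) : ℂ) * z₂) =
      (d : ℂ) ^ 2 * (z₁ * conj z₂) := by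
  have hτ := finTau_mul_conj_eq_one L v a μ hμ hreg
  have hκ := intCast_finKappaAt_mul_self_eq_one L v H' a b hp hreg
  simp only [map_mul, Complex.conj_ofReal, map_intCast]
  calc finTau L v a μ * (d : ℂ) * ((finKappaAt L v H' a b : ℤ) : ℂ) * z₁ *
        (conj (finTau L v a μ) * (d : ℂ) * ((finKappaAt L v H' a b : ℤ) : ℂ) * conj z₂)
      = (finTau L v a μ * conj (finTau L v a μ)) * (((finKappaAt L v H' a b : ℤ) : ℂ) * ((finKappaAt L v H' a b : ℤ) : ℂ)) *
          ((d : ℂ) ^ 2 * (z₁ * conj z₂)) := by ring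
    _ = (d : ℂ) ^ 2 * (z₁ * conj z₂) := by rw [hτ, hκ, one_mul, one_mul]

end Summit.HodgeConjecture.HodgeConjecture.Cruxes.H413.F0P3cStCharTSEllInnerUnitWeights

end
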